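import Summits.QuantumAdvantage.QuantumAdvantage.Theorems.RandomOracleGaugeDecoupledCoreAAL1FamilyAddress
import Literature.Computability.QuantumComplexity.InfluenceBounds
import HarnessLib

/-!
# Crux `DecoupledCoreAA` (stmt-QuantumAdvantage-17872), line `l1-family`, stub `stub_l1Family` —
# alternative (B) must AGGREGATE over the family: no single member of the address family has a heavy coordinate

Alternative (B) of `stub_l1Family` measures a coordinate `j` by the AGGREGATE influence `Σ_i E[(g_i − g_i^{⊕j})²]`
over the whole family.  This file shows the aggregation is essential: in the address family
(`…L1FamilyAddress.exists_addressFamily`) every INDIVIDUAL member–coordinate influence is `≤ 2·2^{-m}` (a member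
`1[addr = t]` changes under a bit flip only on the two address classes involved), while all masses are `2^{-m}` — so the
variant of the stub with (B) replaced by "some member has a coordinate of influence `≥ C/d^c`" is FALSE.

* `exists_addressFamily_individual` — the address family with, in addition, `E[(g_i − g_i^{⊕j})²] ≤ 2/2^m` for EVERY
  member `i` and EVERY coordinate `j`.
* `not_l1Family_individualInfluence` — `¬ [(A) ∨ (∃ j i, C/d^c ≤ E[(g_i − g_i^{⊕j})²])]` in the stub's quantifier shape.

Reading for proof strategies: a proof of the stub cannot look for a heavy (member, coordinate) pair; the `z`-side mass
must be collected across `2^{Θ(d)}` members.  Honest label: calibration; no stub, crux or summit is closed.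
Sources: de Wolf 2008 §4.4 (address function); O'Donnell–Zhao arXiv:1512.01603 eqn. (2.1).
-/

-- D-0017: single-conjunct summit ⇒ the duplicate `QuantumAdvantage.QuantumAdvantage` is mandated.
set_option linter.dupNamespace false

noncomputable section

open Finset
open Literature.Computability.QuantumComplexity
open Literature.Computability.QuantumComplexity.AddressFunction (addr)
open Summit.QuantumAdvantage.QuantumAdvantage.Theorems.SosSandwich.SqrtInfluenceAddress (boolAvg_ite_addr)
open Summit.QuantumAdvantage.QuantumAdvantage.Cruxes.DecoupledCoreAA.L1Family.Address
  (exists_addrClassPoly addr_flipBit_castAdd_ne sum_sq_ite_sub_ite sum_boolAvg_eq exists_pow_lt_mul_two_pow)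

namespace Summit.QuantumAdvantage.QuantumAdvantage.Cruxes.DecoupledCoreAA.L1Family.AddressIndividual

variable {m : ℕ}

/-- A `{0,1}`-valued indicator changes under a bit flip by at most its own value plus the flipped value:
`(a − b)² ≤ a + b` for `a, b ∈ {0,1}`. [folklore] -/
theorem sq_ite_sub_ite_le (P Q : Prop) [Decidable P] [Decidable Q] :
    ((if P then (1 : ℝ) else 0) - (if Q then (1 : ℝ) else 0)) ^ 2 ≤
      (if P then (1 : ℝ) else 0) + (if Q then (1 : ℝ) else 0) := by
  by_cases hP : P <;> by_cases hQ : Q <;> simp [hP, hQ]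

/-- **Individual influences of an address class are tiny**: for the indicator of `{addr = t}` and ANY coordinate
`j`, `E[(1[addr z = t] − 1[addr z^{⊕j} = t])²] ≤ 2/2^m`. [cite: DeWolf2008, §4.4 p. 10] -/
theorem boolAvg_sq_sub_addrClass_le (t : Fin (2 ^ m)) (j : Fin (m + 2 ^ m)) :
    boolAvg (fun z : Fin (m + 2 ^ m) → Bool =>
      ((if addr z = t then (1 : ℝ) else 0) - (if addr (flipBit j z) = t then (1 : ℝ) else 0)) ^ 2) ≤
      2 / (2 : ℝ) ^ m := by
  have hflip : boolAvg (fun z : Fin (m + 2 ^ m) → Bool => if addr (flipBit j z) = t then (1 : ℝ) else 0) =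
      1 / (2 : ℝ) ^ m := by
    rw [← boolAvg_ite_addr t]
    unfold boolAvg
    rw [sum_flipBit j (fun z : Fin (m + 2 ^ m) → Bool => if addr z = t then (1 : ℝ) else 0)]
  calc boolAvg (fun z : Fin (m + 2 ^ m) → Bool =>
        ((if addr z = t then (1 : ℝ) else 0) - (if addr (flipBit j z) = t then (1 : ℝ) else 0)) ^ 2)
      ≤ boolAvg (fun z : Fin (m + 2 ^ m) → Bool =>
          (if addr z = t then (1 : ℝ) else 0) + (if addr (flipBit j z) = t then (1 : ℝ) else 0)) := by
        unfold boolAvg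
        exact div_le_div_of_nonneg_right (Finset.sum_le_sum fun z _ => sq_ite_sub_ite_le _ _) (by positivity)
    _ = boolAvg (fun z : Fin (m + 2 ^ m) → Bool => if addr z = t then (1 : ℝ) else 0) +
          boolAvg (fun z : Fin (m + 2 ^ m) → Bool => if addr (flipBit j z) = t then (1 : ℝ) else 0) := by
        unfold boolAvg
        rw [← add_div, Finset.sum_add_distrib]
    _ = 2 / (2 : ℝ) ^ m := by rw [boolAvg_ite_addr, hflip]; ring

/-- **The address family, with individual influences.**  As `…L1FamilyAddress.exists_addressFamily` (degrees `≤ m`,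
`Σ_i |g_i| ≡ 1`, masses `≤ 2^{-m}`, total mass `1`, address bits of AGGREGATE influence `2`), and in addition: every
member `i` and every coordinate `j` have INDIVIDUAL influence `E[(g_i − g_i^{⊕j})²] ≤ 2/2^m`.
[cite: DeWolf2008, §4.4 p. 10] [cite: ODonnellZhao2016, eqn. (2.1)] -/
theorem exists_addressFamily_individual (m : ℕ) :
    ∃ g : Fin (m + 2 ^ m) → MvPolynomial (Fin (m + 2 ^ m)) ℝ,
      (∀ i, (g i).totalDegree ≤ m) ∧
      (∀ z, ∑ i, |evalBool (g i) z| = 1) ∧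
      (∀ i, boolAvg (fun z => evalBool (g i) z ^ 2) ≤ 1 / (2 : ℝ) ^ m) ∧
      ∑ i, boolAvg (fun z => evalBool (g i) z ^ 2) = 1 ∧
      (∀ j : Fin m, ∑ i, boolAvg (fun z =>
        (evalBool (g i) z - evalBool (g i) (flipBit (Fin.castAdd (2 ^ m) j) z)) ^ 2) = 2) ∧
      (∀ i j, boolAvg (fun z => (evalBool (g i) z - evalBool (g i) (flipBit j z)) ^ 2) ≤ 2 / (2 : ℝ) ^ m) := by
  classical
  -- adapted from `…L1FamilyAddress.exists_addressFamily` (same construction, one more clause)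
  choose r hrdeg hrev using fun t : Fin (2 ^ m) => exists_addrClassPoly t
  have h0 : ∀ w : Fin (m + 2 ^ m) → Bool, evalBool (0 : MvPolynomial (Fin (m + 2 ^ m)) ℝ) w = 0 := by
    intro w; unfold evalBool; exact map_zero _
  refine ⟨Fin.append (fun _ : Fin m => (0 : MvPolynomial (Fin (m + 2 ^ m)) ℝ)) r, ?_, ?_, ?_, ?_, ?_, ?_⟩
  · intro i
    refine Fin.addCases (fun j => ?_) (fun t => ?_) i
    · rw [Fin.append_left, MvPolynomial.totalDegree_zero]; exact Nat.zero_le _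
    · rw [Fin.append_right]; exact hrdeg t
  · intro z
    rw [Fin.sum_univ_add]
    simp only [Fin.append_left, Fin.append_right]
    simp_rw [h0, abs_zero, Finset.sum_const_zero, zero_add, hrev]
    have habs : ∀ t : Fin (2 ^ m), |(if addr z = t then (1 : ℝ) else 0)| = if addr z = t then (1 : ℝ) else 0 :=
      fun t => by split_ifs <;> simp
    simp_rw [habs]
    rw [Finset.sum_ite_eq Finset.univ (addr z), if_pos (Finset.mem_univ _)]
  · intro i
    refine Fin.addCases (fun j => ?_) (fun t => ?_) i
    · simp_rw [Fin.append_left, h0]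
      rw [zero_pow two_ne_zero, boolAvg_const]
      positivity
    · simp_rw [Fin.append_right, hrev t]
      have hsq : ∀ z : Fin (m + 2 ^ m) → Bool,
          (if addr z = t then (1 : ℝ) else 0) ^ 2 = if addr z = t then (1 : ℝ) else 0 :=
        fun z => by split_ifs <;> simp
      simp_rw [hsq]
      rw [boolAvg_ite_addr t]
  · rw [sum_boolAvg_eq]
    have h1 : ∀ z : Fin (m + 2 ^ m) → Bool,
        ∑ i, evalBool (Fin.append (fun _ : Fin m => (0 : MvPolynomial (Fin (m + 2 ^ m)) ℝ)) r i) z ^ 2 = 1 := by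
      intro z
      rw [Fin.sum_univ_add]
      simp only [Fin.append_left, Fin.append_right]
      simp_rw [h0, zero_pow two_ne_zero, Finset.sum_const_zero, zero_add, hrev]
      have hsq : ∀ t : Fin (2 ^ m), (if addr z = t then (1 : ℝ) else 0) ^ 2 = if addr z = t then (1 : ℝ) else 0 :=
        fun t => by split_ifs <;> simp
      simp_rw [hsq]
      rw [Finset.sum_ite_eq Finset.univ (addr z), if_pos (Finset.mem_univ _)]
    simp_rw [h1]
    exact boolAvg_const 1
  · intro j
    rw [sum_boolAvg_eq]
    have h2 : ∀ z : Fin (m + 2 ^ m) → Bool,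
        ∑ i, (evalBool (Fin.append (fun _ : Fin m => (0 : MvPolynomial (Fin (m + 2 ^ m)) ℝ)) r i) z -
          evalBool (Fin.append (fun _ : Fin m => (0 : MvPolynomial (Fin (m + 2 ^ m)) ℝ)) r i)
            (flipBit (Fin.castAdd (2 ^ m) j) z)) ^ 2 = 2 := by
      intro z
      rw [Fin.sum_univ_add]
      simp only [Fin.append_left, Fin.append_right]
      simp_rw [h0, sub_zero, zero_pow two_ne_zero, Finset.sum_const_zero, zero_add, hrev]
      exact sum_sq_ite_sub_ite (addr_flipBit_castAdd_ne z j)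
    simp_rw [h2]
    exact boolAvg_const 2
  · intro i j
    refine Fin.addCases (fun j' => ?_) (fun t => ?_) i
    · simp_rw [Fin.append_left, h0, sub_zero]
      rw [zero_pow two_ne_zero, boolAvg_const]
      positivity
    · simp_rw [Fin.append_right, hrev t]
      exact boolAvg_sq_sub_addrClass_le t j

/-- **Alternative (B) cannot be replaced by an individual member–coordinate influence.**  The variant of `stub_l1Family`
concluding `(∃ i, C/d^c ≤ E[g_i²]) ∨ (∃ j i, C/d^c ≤ E[(g_i − g_i^{⊕j})²])` is FALSE: the address family at `d = m`
(regime `(κ₀, K₀) = (0, 1)`) has all masses `2^{-m}` and all individual influences `≤ 2·2^{-m}`, both `< C/m^c` for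
large `m`. [cite: ODonnellZhao2016, eqn. (2.1)] [cite: DeWolf2008, §4.4 p. 10] -/
theorem not_l1Family_individualInfluence :
    ¬ (∀ (κ₀ : ℕ) (K₀ : ℝ), 0 < K₀ → ∃ (c : ℕ) (C : ℝ), 0 < C ∧
      ∀ (N d : ℕ) (g : Fin N → MvPolynomial (Fin N) ℝ), 1 ≤ d → (∀ i, (g i).totalDegree ≤ d) →
        (∀ z, ∑ i, |evalBool (g i) z| ≤ 1) →
        1 ≤ K₀ * (d : ℝ) ^ κ₀ * ∑ i, boolAvg (fun z => evalBool (g i) z ^ 2) →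
        (∃ i, C / (d : ℝ) ^ c ≤ boolAvg (fun z => evalBool (g i) z ^ 2)) ∨
        (∃ j i, C / (d : ℝ) ^ c ≤ boolAvg (fun z => (evalBool (g i) z - evalBool (g i) (flipBit j z)) ^ 2))) := by
  intro h
  obtain ⟨c, C, hC, hh⟩ := h 0 1 one_pos
  obtain ⟨m, hm, hlt⟩ := exists_pow_lt_mul_two_pow c (show 0 < C / 2 by positivity)
  obtain ⟨g, hdeg, hl1, hmass, htot, -, hind⟩ := exists_addressFamily_individual m
  have hreg : 1 ≤ (1 : ℝ) * (m : ℝ) ^ 0 * ∑ i, boolAvg (fun z => evalBool (g i) z ^ 2) := by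
    rw [htot]; norm_num
  have hm0 : (0 : ℝ) < (m : ℝ) ^ c := by positivity
  have h2 : (0 : ℝ) < (2 : ℝ) ^ m := by positivity
  -- `C/m^c > 2/2^m ≥ 1/2^m`
  have hbig : 2 / (2 : ℝ) ^ m < C / (m : ℝ) ^ c := by
    rw [div_lt_div_iff₀ h2 hm0]
    linarith
  rcases hh (m + 2 ^ m) m g hm hdeg (fun z => (hl1 z).le) hreg with ⟨i, hi⟩ | ⟨j, i, hji⟩
  · have hle : C / (m : ℝ) ^ c ≤ 1 / (2 : ℝ) ^ m := hi.trans (hmass i)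
    have h12 : 1 / (2 : ℝ) ^ m ≤ 2 / (2 : ℝ) ^ m := div_le_div_of_nonneg_right (by norm_num) h2.le
    linarith
  · have hle : C / (m : ℝ) ^ c ≤ 2 / (2 : ℝ) ^ m := hji.trans (hind i j)
    linarith

end Summit.QuantumAdvantage.QuantumAdvantage.Cruxes.DecoupledCoreAA.L1Family.AddressIndividual

end
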